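import Summits.RiemannHypothesis.RiemannHypothesis.Theorems.Splittings.ScrewKreinDiscreteLaplace

/-!
# Screw index transfer, discrete Kreĭn core (3/3, v2): `IndexBounded ⟺ FOZ` and T2 «ETAIL ⟺ FOZ», unconditionally

rh-split-screw-bridge g6, lane (xii-d), file 3 of 3, v2 (cut of `xiid/ScrewKreinDiscreteCoreV2.lean`, §7–§10; uses the landed
(xii-c) lemmas `integrableOn_fC_Ioi'`, `integrableOn_Ioi_comp_sub`, `inner_laplace_shift` (`…ScrewIndexTransferKreinCore`),
`differentiableOn_lap`, `differentiable_innerInt` (`…ScrewKreinCoreLaplace`) BY NAME).  Discharges the cell's residual KB1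
(`Literature.Analysis.OperatorTheory.Stewart1972_thm_3_1`): over the standard axioms only,

* `indexBounded_imp_foz` : `(∃ K, ∀ n, #{i | eig_i(screwMatrix n) < 0} ≤ K) → CofiniteCriticalLine`;
* `indexBounded_iff_foz` (converse = tree `FozIndexBound.fozIndexBound`);  `indexTransferKrein : IndexTransferKrein`;
* `etail_iff_foz` : **T2** `(∃ M₀, ∀ M ≥ M₀, 0 < screwPivot M) ↔ CofiniteCriticalLine`
  (tree `ScrewNullComb.etail_iff_foz_iff_indexTransfer` + `indexBounded_imp_foz`).

Argument: §7 `lap_orbitFun_eq`: on `Re w > 1`, `Lap g_ψ(w) = S_ψ(w)·(−w⁻² ξ'/ξ(½ + w)) + H_ψ(w)` with `S_ψ, H_ψ` entire and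
`Lap g_ψ` holomorphic on `Re w > 0` (bounded `g_ψ`, file 2/3 §5); the landed order argument `pieceC_holds` gives
`S_ψ(w₀) = 0` at each zero `½ + w₀`, `Re w₀ > 0`; `S_ψ(w) = conj(A_ψ(−w̄))·A_ψ(w)`, so (§8, file 2/3 §4) `e^{ηw₀}` lies in a
finite set for EVERY step `η ≠ 0`; §9 two incommensurable steps `η = 1, √2` leave finitely many `w₀` (`w ↦ (e^w, e^{√2 w})` is
injective); §9–§10 FOZ by the functional equation, and the assembly.

Classification tags: [folklore] = standard analysis/algebra; [new-combination] = assembled here.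
HONEST LABEL: SPLITTING SEARCH over kernel-typed RH-EQUIVALENCES; `etail_iff_foz` relates two OPEN tail statements and
decides neither; nothing here bears on the truth of RH.
-/

noncomputable section

set_option linter.dupNamespace false

namespace Summit.RiemannHypothesis.RiemannHypothesis.Theorems.Splittings.ScrewKreinDiscrete

open Finset Complex MeasureTheory Set Filter Topology Polynomial Module
open scoped ComplexConjugate Matrix
open Literature.NumberTheory.LFunctions
open Literature.Analysis.OperatorTheory
open Literature.Analysis.OperatorTheory.KreinStewart
open Summit.RiemannHypothesis.RiemannHypothesis.Theses.RuelleBand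
open Summit.RiemannHypothesis.RiemannHypothesis.Theorems.IntegerScrew
open Summit.RiemannHypothesis.RiemannHypothesis.Theorems.Splittings.ScrewKreinCore
open Summit.RiemannHypothesis.RiemannHypothesis.Theorems.Splittings.ScrewIndexTransferKrein

/-! ## §7 The Laplace transform of the orbit function: `Lap g_ψ = S_ψ · (−w⁻²ξ'/ξ(½+w)) + H_ψ` -/

/-- The multiplier `S_ψ(w) = Σ_s Σ_t conj(ψ s) ψ t e^{−w(s−t)}` (an exponential polynomial). -/
def symb (ψ : ℝ →₀ ℂ) (w : ℂ) : ℂ :=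
  ∑ s ∈ ψ.support, ∑ t ∈ ψ.support, conj (ψ s) * ψ t * cexp (-(w * ((s - t : ℝ) : ℂ)))

/-- The entire correction term `H_ψ(w) = Σ_s Σ_t conj(ψ s) ψ t e^{−w(s−t)} ∫_{−(s−t)}^0 fC e^{−w·}`. -/
def corrH (ψ : ℝ →₀ ℂ) (w : ℂ) : ℂ :=
  ∑ s ∈ ψ.support, ∑ t ∈ ψ.support, conj (ψ s) * ψ t *
    (cexp (-(w * ((s - t : ℝ) : ℂ))) * ∫ r in (-(s - t : ℝ))..0, fC r * cexp (-(w * r)))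

/-- `S_ψ` is entire. [folklore] -/
theorem differentiable_symb (ψ : ℝ →₀ ℂ) : Differentiable ℂ (symb ψ) := by
  unfold symb
  fun_prop

/-- `H_ψ` is entire. [folklore] -/
theorem differentiable_corrH (ψ : ℝ →₀ ℂ) : Differentiable ℂ (corrH ψ) := by
  unfold corrH
  refine Differentiable.fun_sum fun s _ => Differentiable.fun_sum fun t _ => ?_
  exact (differentiable_const _).mul
    ((by fun_prop : Differentiable ℂ fun w : ℂ => cexp (-(w * ((s - t : ℝ) : ℂ)))).mul
      (differentiable_innerInt (s - t)))

/-- **The Laplace identity** on `Re w > 1`: `Lap g_ψ(w) = S_ψ(w) · (−w^{-2} ξ'/ξ(½ + w)) + H_ψ(w)`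
(shift formula `inner_laplace_shift` termwise + `pieceBp`). [new-combination] -/
theorem lap_orbitFun_eq (ψ : ℝ →₀ ℂ) {w : ℂ} (hw : 1 < w.re) :
    lap (orbitFun ψ) w = symb ψ w * lapF w + corrH ψ w := by
  have hw' : 1 / 2 < w.re := by linarith
  -- integrability of each shifted term
  have hint : ∀ u : ℝ, IntegrableOn (fun a : ℝ => fC (a - u) * cexp (-(w * a))) (Ioi 0) := by
    intro u
    have e : (fun a : ℝ => fC (a - u) * cexp (-(w * a))) =
        fun a => (fun r : ℝ => cexp (-(w * u)) * (fC r * cexp (-(w * r)))) (a - u) := by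
      funext a; simp only
      rw [show -(w * (a : ℂ)) = -(w * u) + -(w * ((a - u : ℝ) : ℂ)) by push_cast; ring, Complex.exp_add]
      ring
    rw [e]
    exact integrableOn_Ioi_comp_sub ((integrableOn_fC_Ioi' hw' (-u)).const_mul _)
  have hterm : ∀ s t : ℝ, Integrable (fun a : ℝ => conj (ψ s) * ψ t * (fC (a - (s - t)) * cexp (-(w * a))))
      (volume.restrict (Ioi 0)) := fun s t => (hint (s - t)).const_mul _
  -- rewrite the integrand
  have h1 : lap (orbitFun ψ) w = ∫ a in Ioi (0 : ℝ), ∑ s ∈ ψ.support, ∑ t ∈ ψ.support,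
      conj (ψ s) * ψ t * (fC (a - (s - t)) * cexp (-(w * a))) := by
    rw [lap]
    refine setIntegral_congr_fun measurableSet_Ioi fun a _ => ?_
    rw [orbitFun_eq, Finset.sum_mul]
    refine Finset.sum_congr rfl fun s _ => ?_
    rw [Finset.sum_mul]
    refine Finset.sum_congr rfl fun t _ => ?_
    rw [show t + a - s = a - (s - t) by ring]
    ring
  rw [h1, integral_finsetSum _ fun s _ => integrable_finsetSum _ fun t _ => hterm s t]
  simp_rw [integral_finsetSum _ fun t _ => hterm _ t, integral_const_mul]
  -- the shift formula termwise
  have h2 : ∀ s t : ℝ, (∫ a in Ioi (0 : ℝ), fC (a - (s - t)) * cexp (-(w * a))) =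
      cexp (-(w * ((s - t : ℝ) : ℂ))) * ((∫ r in (-(s - t : ℝ))..0, fC r * cexp (-(w * r))) + lapF w) := by
    intro s t
    rw [inner_laplace_shift hw' (s - t), pieceBp hw]
  simp_rw [h2]
  rw [symb, corrH, Finset.sum_mul, ← Finset.sum_add_distrib]
  refine Finset.sum_congr rfl fun s _ => ?_
  rw [Finset.sum_mul, ← Finset.sum_add_distrib]
  refine Finset.sum_congr rfl fun t _ => ?_
  ring

/-- **Order argument** (landed `pieceC_holds`): for a bounded orbit function, the multiplier `S_ψ` vanishes at every
zero `½ + w₀`, `Re w₀ > 0`, of `ξ`. [new-combination] -/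
theorem symb_eq_zero_of_zero (ψ : ℝ →₀ ℂ) (C : ℝ) (hC : ∀ a, ‖orbitFun ψ a‖ ≤ C) {w₀ : ℂ}
    (hw₀ : 0 < w₀.re) (hξ : riemannXi (1 / 2 + w₀) = 0) : symb ψ w₀ = 0 :=
  pieceC_holds (lap (orbitFun ψ)) (corrH ψ) (symb ψ)
    (differentiableOn_lap (continuous_orbitFun ψ) C hC) (differentiable_corrH ψ)
    (differentiable_symb ψ) (fun _ hw => lap_orbitFun_eq ψ hw) w₀ hw₀ hξ

/-- Factorisation of the multiplier: `S_ψ(w) = conj(A_ψ(−w̄)) · A_ψ(w)`. [folklore] -/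
theorem symb_eq_expSum (ψ : ℝ →₀ ℂ) (w : ℂ) :
    symb ψ w = conj (expSum ψ (-conj w)) * expSum ψ w := by
  rw [symb, expSum, expSum, map_sum, Finset.sum_mul_sum]
  refine Finset.sum_congr rfl fun s _ => Finset.sum_congr rfl fun t _ => ?_
  rw [map_mul, ← Complex.exp_conj, map_mul, map_neg, Complex.conj_conj, Complex.conj_ofReal]
  rw [show -(w * ((s - t : ℝ) : ℂ)) = -w * s + w * t by push_cast; ring, Complex.exp_add]
  ring

/-! ## §8 Per step `η`: the zeros confine `e^{η w₀}` to a finite set -/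

/-- **Per-step confinement.** Under `IndexBounded`, for every step `η ≠ 0` there is a finite set `Z ⊆ ℂ` with
`e^{η w₀} ∈ Z` for every zero `½ + w₀` (`Re w₀ > 0`) of `ξ`. [new-combination] -/
theorem exists_finset_exp_mem (K : ℕ)
    (hK : ∀ n : ℕ, (univ.filter fun i => (screwMatrix_isHermitian n).eigenvalues i < 0).card ≤ K)
    (η : ℝ) (hη : η ≠ 0) :
    ∃ Z : Finset ℂ, ∀ w₀ : ℂ, 0 < w₀.re → riemannXi (1 / 2 + w₀) = 0 → cexp (η * w₀) ∈ Z := by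
  classical
  obtain ⟨P, hP0, -, hpos⟩ := exists_definitizer K hK η
  set R : Module.End ℂ (ℝ →₀ ℂ) := aeval (SDOp η : Module.End ℂ (ℝ →₀ ℂ)) P with hR
  set ψ : ℝ →₀ ℂ := R (Finsupp.single 0 1) with hψ
  -- boundedness of the orbit function
  have hbd : ∀ a, ‖orbitFun ψ a‖ ≤ (BF fC ψ ψ).re := fun a =>
    norm_orbitFun_le R (fun a => commute_U_aeval a η P) hpos a
  -- lattice structure of ψ
  obtain ⟨hsupp, htopv⟩ := aeval_single_support η hη P
  have hc0 : ((2 : ℂ) * Complex.I * η)⁻¹ ≠ 0 := by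
    refine inv_ne_zero (mul_ne_zero (mul_ne_zero two_ne_zero Complex.I_ne_zero) ?_)
    exact_mod_cast hη
  have htop : ψ ((P.natDegree : ℝ) * η) ≠ 0 := by
    rw [hψ, hR, htopv]
    exact mul_ne_zero (Polynomial.leadingCoeff_ne_zero.mpr hP0) (pow_ne_zero _ hc0)
  obtain ⟨Z₀, hZ₀⟩ := exists_finset_expSum_eq_zero η hη P.natDegree ψ hsupp htop
  refine ⟨Z₀ ∪ Z₀.image fun z => (conj z)⁻¹, fun w₀ hw₀ hξ => ?_⟩
  have hS := symb_eq_zero_of_zero ψ _ hbd hw₀ hξ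
  rw [symb_eq_expSum, mul_eq_zero] at hS
  rcases hS with h | h
  · -- `A_ψ(−w̄₀) = 0`
    have h' : expSum ψ (-conj w₀) = 0 := by simpa using h
    have hmem := hZ₀ _ h'
    refine Finset.mem_union_right _ (Finset.mem_image.mpr ⟨_, hmem, ?_⟩)
    rw [show (η : ℂ) * -conj w₀ = conj (-(η * w₀)) by
      rw [map_neg, map_mul, Complex.conj_ofReal]; ring, Complex.exp_conj, Complex.conj_conj,
      Complex.exp_neg, inv_inv]
  · exact Finset.mem_union_left _ (hZ₀ _ h)

/-! ## §9 Two incommensurable steps: finitely many candidates, hence FOZ -/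

/-- `w ↦ (e^{w}, e^{√2 w})` is injective (irrationality of `√2`), so finitely many values on each coordinate leave
finitely many `w`. [folklore] -/
theorem finite_candidates (Z₁ Z₂ : Finset ℂ) :
    {w : ℂ | cexp w ∈ Z₁ ∧ cexp ((Real.sqrt 2 : ℝ) * w) ∈ Z₂}.Finite := by
  have hsub : {w : ℂ | cexp w ∈ Z₁ ∧ cexp ((Real.sqrt 2 : ℝ) * w) ∈ Z₂} ⊆
      ⋃ z₁ ∈ (Z₁ : Set ℂ), ⋃ z₂ ∈ (Z₂ : Set ℂ),
        {w : ℂ | cexp w = z₁ ∧ cexp ((Real.sqrt 2 : ℝ) * w) = z₂} := by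
    intro w hw
    simp only [Set.mem_iUnion, Set.mem_setOf_eq, Finset.mem_coe, exists_prop]
    exact ⟨_, hw.1, _, hw.2, rfl, rfl⟩
  refine Set.Finite.subset ?_ hsub
  refine Z₁.finite_toSet.biUnion fun z₁ _ => Z₂.finite_toSet.biUnion fun z₂ _ => ?_
  refine Set.Subsingleton.finite fun w hw w' hw' => ?_
  obtain ⟨n, hn⟩ := Complex.exp_eq_exp_iff_exists_int.mp (hw.1.trans hw'.1.symm)
  obtain ⟨m, hm⟩ := Complex.exp_eq_exp_iff_exists_int.mp (hw.2.trans hw'.2.symm)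
  have h2pi : (2 * (Real.pi : ℂ) * Complex.I) ≠ 0 := by
    refine mul_ne_zero (mul_ne_zero two_ne_zero ?_) Complex.I_ne_zero
    exact_mod_cast Real.pi_ne_zero
  have key : ((Real.sqrt 2 : ℝ) : ℂ) * n = m := by
    have h0 : (((Real.sqrt 2 : ℝ) : ℂ) * n - m) * (2 * (Real.pi : ℂ) * Complex.I) = 0 := by
      linear_combination hm - ((Real.sqrt 2 : ℝ) : ℂ) * hn
    rcases mul_eq_zero.mp h0 with h | h
    · exact sub_eq_zero.mp h
    · exact absurd h h2pi
  by_cases hn0 : n = 0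
  · rw [hn, hn0]; simp
  · exfalso
    have hreal : Real.sqrt 2 * n = m := by exact_mod_cast key
    have hne := (irrational_iff_ne_rational _).mp irrational_sqrt_two m n
    have hn0' : (n : ℝ) ≠ 0 := by exact_mod_cast hn0
    exact hne hn0 ((eq_div_iff hn0').mpr hreal)

/-- From a finite candidate set for the zeros `½ + w₀`, `Re w₀ > 0`, to `CofiniteCriticalLine` (as in the landed
`pieceF_holds`, with the functional equation for the left half). [folklore] -/
theorem foz_of_finite_candidates {C : Set ℂ} (hC : C.Finite)
    (hz : ∀ w₀ : ℂ, 0 < w₀.re → riemannXi (1 / 2 + w₀) = 0 → w₀ ∈ C) : CofiniteCriticalLine := by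
  set Sp : Set ℂ := (fun w => 1 / 2 + w) '' C with hSp_def
  have hSp : Sp.Finite := hC.image _
  have key : ∀ s : ℂ, riemannZeta s = 0 → 0 < s.re → s.re < 1 → 1 / 2 < s.re → s ∈ Sp := by
    intro s h0 h1 h2 h3
    have hξ : riemannXi (1 / 2 + (s - 1 / 2)) = 0 := by
      rw [show (1 / 2 : ℂ) + (s - 1 / 2) = s by ring]
      exact (riemannXi_eq_zero_iff_holds s).2 ⟨h0, h1, h2⟩
    have hw : 0 < (s - 1 / 2).re := by simp; linarith
    exact ⟨s - 1 / 2, hz _ hw hξ, by ring⟩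
  refine (hSp.union (hSp.image fun z => 1 - z)).subset ?_
  rintro s ⟨h0, h1, h2, h3⟩
  rcases lt_or_gt_of_ne h3 with hlt | hgt
  · right
    have hξ : riemannXi (1 - s) = 0 := by
      rw [riemannXi_one_sub]; exact (riemannXi_eq_zero_iff_holds s).2 ⟨h0, h1, h2⟩
    obtain ⟨h0', h1', h2'⟩ := (riemannXi_eq_zero_iff_holds (1 - s)).1 hξ
    refine ⟨1 - s, key (1 - s) h0' h1' h2' ?_, by ring⟩
    simp; linarith
  · exact Or.inl (key s h0 h1 h2 hgt)

/-! ## §10 Assembly: `IndexBounded ⟹ FOZ` and T2 «ETAIL ⟺ FOZ», unconditionally -/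

/-- **`IndexBounded ⟹ FOZ`, with NO named fact.**  A uniform bound on the negative index of Suzuki's screw node
matrices `S_n` forces all but finitely many non-trivial zeros of `ζ` onto the critical line.  (Lane (xii-c)'s
`indexBounded_imp_foz` had the hypothesis `Stewart1972_thm_3_1`; here Kreĭn's theorem is replaced by the tree's
elementary `KreinStewart.abs_definitization` on point masses with the difference operator `SDOp η`, and the
polynomial count by a two-step exponential-polynomial count.) [new-combination] -/
theorem indexBounded_imp_foz
    (hK : ∃ K : ℕ, ∀ n : ℕ, (univ.filter fun i => (screwMatrix_isHermitian n).eigenvalues i < 0).card ≤ K) :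
    CofiniteCriticalLine := by
  obtain ⟨K, hK⟩ := hK
  obtain ⟨Z₁, hZ₁⟩ := exists_finset_exp_mem K hK 1 one_ne_zero
  obtain ⟨Z₂, hZ₂⟩ := exists_finset_exp_mem K hK (Real.sqrt 2) (Real.sqrt_pos.mpr two_pos).ne'
  refine foz_of_finite_candidates (finite_candidates Z₁ Z₂) fun w₀ hw₀ hξ => ⟨?_, hZ₂ w₀ hw₀ hξ⟩
  have := hZ₁ w₀ hw₀ hξ
  simpa using this

/-- **`IndexBounded ⟺ FOZ`** (converse: tree R1 `FozIndexBound.fozIndexBound`). [new-combination] -/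
theorem indexBounded_iff_foz :
    (∃ K : ℕ, ∀ n : ℕ, (univ.filter fun i => (screwMatrix_isHermitian n).eigenvalues i < 0).card ≤ K) ↔
      CofiniteCriticalLine :=
  ⟨indexBounded_imp_foz,
    Summit.RiemannHypothesis.RiemannHypothesis.Theorems.IntegerScrew.FozIndexBound.fozIndexBound⟩

/-- `IndexTransferKrein` holds outright (its Kreĭn hypothesis is not needed). [new-combination] -/
theorem indexTransferKrein : IndexTransferKrein := fun _ hK => indexBounded_imp_foz hK

/-- **T2 «ETAIL ⟺ FOZ», UNCONDITIONAL.**  Suzuki's screw pivots are eventually positive iff all but finitely many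
non-trivial zeros of `ζ` lie on the critical line (tree: `ScrewNullComb.etail_iff_foz_iff_indexTransfer`, i.e.
`etail_iff_boundedIndex` + `fozIndexBound`, and `indexBounded_imp_foz`).  HONEST LABEL: neither side is RH or the screw
criterion; this relates two tails and decides neither. [new-combination] -/
theorem etail_iff_foz : (∃ M₀ : ℕ, ∀ M : ℕ, M₀ ≤ M → 0 < screwPivot M) ↔ CofiniteCriticalLine :=
  Summit.RiemannHypothesis.RiemannHypothesis.Theorems.Splittings.ScrewNullComb.etail_iff_foz_iff_indexTransfer.mpr
    indexBounded_imp_foz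

end Summit.RiemannHypothesis.RiemannHypothesis.Theorems.Splittings.ScrewKreinDiscrete
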